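import Summits.CriticalPhenomena.PercolationContinuityZ3.Theorems.Transplant.Z3DiagonalGraph
import Mathlib.Tactic.FinCases
import HarnessLib

/-!
# The `cds` net (CdSO₄ topology), I: the graph — `ℤ³` with every vertical bond and, in the layer `x₂ = z`, the horizontal bonds along `e_{z mod 2}`
# only — adjacency, local finiteness, the automorphisms (even translations, the swap-glide, the central inversion, the vertical flip), transitivity

builds on p205010 (kernel theorem, internal audit signed; external expert review pending) — nothing in this file uses p205010.
Lane `prim-bschramm`, seat `prim-bschramm-p2` (gen 11; class C1b "other 3D lattices at their own critical points", METHOD = input substitution);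
helper file (`--supports stmt-CriticalPhenomena-4575 --as helper`).  Memo: `HOME/bschramm/P2-LATTICES.md` §33.

THE NET.  Vertices `ℤ³`; `x ∼ x ± e₂` always; `x ∼ x ± e₀` iff `x₂` is even; `x ∼ x ± e₁` iff `x₂` is odd.  Every vertex is 4-valent with its four bonds in
one vertical plane (square-planar coordination), the plane turning by a quarter turn from each layer to the next — the `cds` (cadmium-sulfate) net of
reticular chemistry, the third of the basic square-planar 4-coordinated nets after the square lattice `sql` and `nbo`.  It is vertex-transitive
(the even translations together with the SWAP-GLIDE `(x₀,x₁,x₂) ↦ (x₁,x₀,x₂+1)`), it is NOT a Cayley graph of `ℤ³` (a 4-valent Cayley graph of `ℤ³` has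
rank ≤ 2) and NOT a box product; it is the Cayley graph of the crystallographic group `ℤ² ⋊ ℤ` (the generator of `ℤ` swapping the two coordinates of `ℤ²`)
on the generators `{t₀^{±1}, g^{±1}}`.  None of the lane's earlier nodes' customer files reach it; file II (`CdsNetSkeleton`) shows it carries a single-type
`PlanarSkeletonSign` over the sheared chart `φ = (x₀ + x₁, x₂)`, whence `θ(p_c) = 0` unconditionally.
* §1 `hdir`, `stepsAt`, **`Cds.graph`**, `graph_adj_iff`, the six adjacency introduction lemmas, `neighborFinset_eq`, degree `≤ 4`, local finiteness;
* §2 automorphisms from adjacency-preserving self-maps with adjacency-preserving inverses (`isoOfMaps`): **`shift v` (`v₂` even), `glide`, `negIso`, `flipZIso`**;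
* §3 `exists_iso_apply_zero` (every vertex is the image of `0`), **`graph_transitive`**, `graph_quasiTransitive`.
[cite: BenjaminiSchramm1996, §2 (Cayley and quasi-transitive graphs), Conj. 4] [cite: GrimmettPercolation1999, §12.1 p. 349 (general lattices)]
-/

noncomputable section

namespace Summit.CriticalPhenomena.PercolationContinuityZ3.Theorems.Transplant

namespace Cds

open Literature.Probability.Percolation Literature.Probability.LatticeModels SimpleGraph
open Literature.Barriers.CriticalPhenomena (IsQuasiTransitive IsGraphTransitive)
open Z3Diag (ev)
open scoped Classical

/-! ## §1 The graph -/

/-- The horizontal bond direction of the layer through `x`: `e₀` on even layers, `e₁` on odd layers. [folklore] -/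
def hdir (x : Site 3) : Fin 3 := if Even (x 2) then 0 else 1

/-- `hdir` on an even layer. [folklore] -/
theorem hdir_of_even {x : Site 3} (h : Even (x 2)) : hdir x = 0 := by simp [hdir, h]

/-- `hdir` on an odd layer. [folklore] -/
theorem hdir_of_not_even {x : Site 3} (h : ¬ Even (x 2)) : hdir x = 1 := by simp [hdir, h]

/-- `hdir` depends on the layer only. [folklore] -/
theorem hdir_congr {x y : Site 3} (h : Even (x 2) ↔ Even (y 2)) : hdir x = hdir y := by
  by_cases hx : Even (x 2)
  · rw [hdir_of_even hx, hdir_of_even (h.1 hx)]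
  · rw [hdir_of_not_even hx, hdir_of_not_even fun hy => hx (h.2 hy)]

/-- The horizontal direction is never the vertical one. [folklore] -/
theorem hdir_ne_two (x : Site 3) : hdir x ≠ 2 := by
  by_cases hx : Even (x 2)
  · rw [hdir_of_even hx]; decide
  · rw [hdir_of_not_even hx]; decide

/-- The vertical coordinate of a horizontal unit vector vanishes. [folklore] -/
theorem ev_hdir_apply_two (x : Site 3) : ev (hdir x) 2 = 0 := by
  rw [ev, Pi.single_apply, if_neg (hdir_ne_two x).symm]

/-- `e₂` has vertical coordinate `1`. [folklore] -/
@[simp] theorem ev_two_apply_two : ev 2 2 = 1 := by simp [ev]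

/-- **The steps at `x`**: `±e_{hdir x}` (horizontal, in the layer's direction) and `±e₂` (vertical). [folklore] -/
def stepsAt (x : Site 3) : Finset (Site 3) := {ev (hdir x), -ev (hdir x), ev 2, -ev 2}

/-- Membership in `stepsAt x`. [folklore] -/
theorem mem_stepsAt_iff {x s : Site 3} : s ∈ stepsAt x ↔ s = ev (hdir x) ∨ s = -ev (hdir x) ∨ s = ev 2 ∨ s = -ev 2 := by
  simp only [stepsAt, Finset.mem_insert, Finset.mem_singleton]

/-- `stepsAt` depends on the layer only. [folklore] -/
theorem stepsAt_congr {x y : Site 3} (h : Even (x 2) ↔ Even (y 2)) : stepsAt x = stepsAt y := by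
  rw [stepsAt, stepsAt, hdir_congr h]

/-- `0` is not a step. [folklore] -/
theorem zero_notMem_stepsAt (x : Site 3) : (0 : Site 3) ∉ stepsAt x := by
  rw [mem_stepsAt_iff]
  push Not
  refine ⟨fun h => ?_, fun h => ?_, fun h => ?_, fun h => ?_⟩
  · have := congrFun h (hdir x); simp [ev] at this
  · have := congrFun h (hdir x); simp [ev] at this
  · have := congrFun h 2; simp [ev] at this
  · have := congrFun h 2; simp [ev] at this

/-- A step is symmetric: if `s` is a step at `x` then `−s` is a step at `x + s`. [folklore] -/
theorem neg_mem_stepsAt_add {x s : Site 3} (hs : s ∈ stepsAt x) : -s ∈ stepsAt (x + s) := by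
  rw [mem_stepsAt_iff] at hs ⊢
  rcases hs with rfl | rfl | rfl | rfl
  · have h : Even (x 2) ↔ Even ((x + ev (hdir x)) 2) := by rw [Pi.add_apply, ev_hdir_apply_two, add_zero]
    rw [← hdir_congr h]; exact Or.inr (Or.inl rfl)
  · have h : Even (x 2) ↔ Even ((x + -ev (hdir x)) 2) := by rw [Pi.add_apply, Pi.neg_apply, ev_hdir_apply_two, neg_zero, add_zero]
    rw [← hdir_congr h, neg_neg]; exact Or.inl rfl
  · exact Or.inr (Or.inr (Or.inr rfl))
  · rw [neg_neg]; exact Or.inr (Or.inr (Or.inl rfl))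

/-- **The `cds` net**: `x ∼ y` iff `y − x` is a step at `x`. [cite: BenjaminiSchramm1996, §2] -/
def graph : SimpleGraph (Site 3) where
  Adj x y := y - x ∈ stepsAt x
  symm := ⟨fun x y (h : y - x ∈ stepsAt x) => by
    show x - y ∈ stepsAt y
    have := neg_mem_stepsAt_add h
    rwa [neg_sub, add_sub_cancel] at this⟩
  loopless := ⟨fun x (h : x - x ∈ stepsAt x) => zero_notMem_stepsAt x (by rwa [sub_self] at h)⟩

/-- Adjacency: `y − x ∈ stepsAt x`. [folklore] -/
theorem graph_adj_iff (x y : Site 3) : graph.Adj x y ↔ y - x ∈ stepsAt x := Iff.rfl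

/-- Adjacency is decidable. [folklore] -/
instance graph_decidableRel : DecidableRel graph.Adj := fun x y => decidable_of_iff _ (graph_adj_iff x y).symm

/-- `x ∼ x + s` for every step `s` at `x`. [folklore] -/
theorem adj_add_of_mem {x s : Site 3} (hs : s ∈ stepsAt x) : graph.Adj x (x + s) := by
  rw [graph_adj_iff, add_sub_cancel_left]; exact hs

/-- `x ∼ x + e₂`. [folklore] -/
theorem adj_add_ev_two (x : Site 3) : graph.Adj x (x + ev 2) := adj_add_of_mem (mem_stepsAt_iff.2 (Or.inr (Or.inr (Or.inl rfl))))

/-- `x ∼ x − e₂`. [folklore] -/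
theorem adj_sub_ev_two (x : Site 3) : graph.Adj x (x - ev 2) := by
  rw [sub_eq_add_neg]; exact adj_add_of_mem (mem_stepsAt_iff.2 (Or.inr (Or.inr (Or.inr rfl))))

/-- `x ∼ x + e_{hdir x}`. [folklore] -/
theorem adj_add_ev_hdir (x : Site 3) : graph.Adj x (x + ev (hdir x)) := adj_add_of_mem (mem_stepsAt_iff.2 (Or.inl rfl))

/-- `x ∼ x − e_{hdir x}`. [folklore] -/
theorem adj_sub_ev_hdir (x : Site 3) : graph.Adj x (x - ev (hdir x)) := by
  rw [sub_eq_add_neg]; exact adj_add_of_mem (mem_stepsAt_iff.2 (Or.inr (Or.inl rfl)))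

/-- On an even layer `x ∼ x + e₀`. [folklore] -/
theorem adj_add_ev_zero {x : Site 3} (hx : Even (x 2)) : graph.Adj x (x + ev 0) := by
  have := adj_add_ev_hdir x; rwa [hdir_of_even hx] at this

/-- On an even layer `x ∼ x − e₀`. [folklore] -/
theorem adj_sub_ev_zero {x : Site 3} (hx : Even (x 2)) : graph.Adj x (x - ev 0) := by
  have := adj_sub_ev_hdir x; rwa [hdir_of_even hx] at this

/-- On an odd layer `x ∼ x + e₁`. [folklore] -/
theorem adj_add_ev_one {x : Site 3} (hx : ¬ Even (x 2)) : graph.Adj x (x + ev 1) := by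
  have := adj_add_ev_hdir x; rwa [hdir_of_not_even hx] at this

/-- On an odd layer `x ∼ x − e₁`. [folklore] -/
theorem adj_sub_ev_one {x : Site 3} (hx : ¬ Even (x 2)) : graph.Adj x (x - ev 1) := by
  have := adj_sub_ev_hdir x; rwa [hdir_of_not_even hx] at this

/-- **Adjacency, spelled out**: the four neighbours of `x` are `x ± e₂` and `x ± e_{hdir x}`. [folklore] -/
theorem graph_adj_iff' (x y : Site 3) :
    graph.Adj x y ↔ y = x + ev (hdir x) ∨ y = x - ev (hdir x) ∨ y = x + ev 2 ∨ y = x - ev 2 := by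
  rw [graph_adj_iff, mem_stepsAt_iff, sub_eq_iff_eq_add', sub_eq_iff_eq_add', sub_eq_iff_eq_add', sub_eq_iff_eq_add', ← sub_eq_add_neg,
    ← sub_eq_add_neg]

/-- The neighbour finset of `x` is the image of `stepsAt x`. [folklore] -/
theorem neighborSet_eq (x : Site 3) : graph.neighborSet x = ↑((stepsAt x).image (x + ·)) := by
  ext y
  rw [SimpleGraph.mem_neighborSet, graph_adj_iff, Finset.coe_image, Set.mem_image]
  constructor
  · intro h; exact ⟨y - x, h, by abel⟩
  · rintro ⟨s, hs, rfl⟩; simpa using hs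

/-- The graph is locally finite. [folklore] -/
instance graph_locallyFinite : graph.LocallyFinite := fun x =>
  (((stepsAt x).image (x + ·)).finite_toSet.subset (neighborSet_eq x).le).fintype

/-- Induced subgraphs are locally finite. [folklore] -/
instance graph_induce_locallyFinite (s : Set (Site 3)) : (graph.induce s).LocallyFinite := fun x =>
  (((graph.neighborSet x.1).toFinite.preimage Subtype.val_injective.injOn).subset
    fun y (hy : (graph.induce s).Adj x y) => by simpa [SimpleGraph.mem_neighborSet] using hy).fintype

/-- **Degree `≤ 4`** (in fact `= 4`). [folklore] -/
theorem graph_degree_le (x : Site 3) : graph.degree x ≤ 4 := by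
  have h : graph.neighborFinset x = (stepsAt x).image (x + ·) := by
    apply Finset.coe_injective; rw [SimpleGraph.coe_neighborFinset, neighborSet_eq]
  rw [← SimpleGraph.card_neighborFinset_eq_degree, h]
  refine Finset.card_image_le.trans ?_
  rw [stepsAt]
  refine (Finset.card_insert_le _ _).trans ?_
  refine (Nat.succ_le_succ (Finset.card_insert_le _ _)).trans ?_
  refine (Nat.succ_le_succ (Nat.succ_le_succ (Finset.card_insert_le _ _))).trans ?_
  rw [Finset.card_singleton]

/-! ## §2 Automorphisms -/

/-- An automorphism from a pair of mutually inverse adjacency-preserving self-maps. [folklore] -/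
def isoOfMaps (σ τ : Site 3 → Site 3) (h₁ : Function.LeftInverse τ σ) (h₂ : Function.RightInverse τ σ)
    (hσ : ∀ x y, graph.Adj x y → graph.Adj (σ x) (σ y)) (hτ : ∀ x y, graph.Adj x y → graph.Adj (τ x) (τ y)) : graph ≃g graph where
  toEquiv := ⟨σ, τ, h₁, h₂⟩
  map_rel_iff' := by
    intro x y
    change graph.Adj (σ x) (σ y) ↔ graph.Adj x y
    constructor
    · intro h
      have h' : graph.Adj (τ (σ x)) (τ (σ y)) := hτ _ _ h
      rwa [h₁ x, h₁ y] at h'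
    · exact hσ x y

/-- `isoOfMaps` acts by `σ`. [folklore] -/
@[simp] theorem isoOfMaps_apply (σ τ : Site 3 → Site 3) (h₁ h₂ hσ hτ) (x : Site 3) : isoOfMaps σ τ h₁ h₂ hσ hτ x = σ x := rfl

/-- A translation by a vector with EVEN vertical part preserves adjacency. [folklore] -/
theorem adj_add_right {v : Site 3} (hv : Even (v 2)) {x y : Site 3} (h : graph.Adj x y) : graph.Adj (x + v) (y + v) := by
  rw [graph_adj_iff] at h ⊢
  rw [add_sub_add_right_eq_sub, stepsAt_congr (show Even ((x + v) 2) ↔ Even (x 2) by rw [Pi.add_apply, Int.even_add]; tauto)]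
  exact h

/-- **Translation by `v` with `v₂` even** is an automorphism. [cite: BenjaminiSchramm1996, §2] -/
def shift (v : Site 3) (hv : Even (v 2)) : graph ≃g graph :=
  isoOfMaps (· + v) (· + -v) (fun x => by simp) (fun x => by simp) (fun _ _ h => adj_add_right hv h)
    (fun _ _ h => adj_add_right (by simpa using hv) h)

/-- `shift v hv x = x + v`. [folklore] -/
@[simp] theorem shift_apply (v : Site 3) (hv : Even (v 2)) (x : Site 3) : shift v hv x = x + v := rfl

/-- The swap-glide `(x₀, x₁, x₂) ↦ (x₁, x₀, x₂ + 1)`. [folklore] -/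
def glideFun (x : Site 3) : Site 3 := ![x 1, x 0, x 2 + 1]

/-- Its inverse `(x₀, x₁, x₂) ↦ (x₁, x₀, x₂ − 1)`. [folklore] -/
def glideInv (x : Site 3) : Site 3 := ![x 1, x 0, x 2 - 1]

/-- Coordinates of the glide. [folklore] -/
@[simp] theorem glideFun_apply_zero (x : Site 3) : glideFun x 0 = x 1 := rfl
/-- Coordinates of the glide. [folklore] -/
@[simp] theorem glideFun_apply_one (x : Site 3) : glideFun x 1 = x 0 := rfl
/-- Coordinates of the glide. [folklore] -/
@[simp] theorem glideFun_apply_two (x : Site 3) : glideFun x 2 = x 2 + 1 := rfl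
/-- Coordinates of the inverse glide. [folklore] -/
@[simp] theorem glideInv_apply_zero (x : Site 3) : glideInv x 0 = x 1 := rfl
/-- Coordinates of the inverse glide. [folklore] -/
@[simp] theorem glideInv_apply_one (x : Site 3) : glideInv x 1 = x 0 := rfl
/-- Coordinates of the inverse glide. [folklore] -/
@[simp] theorem glideInv_apply_two (x : Site 3) : glideInv x 2 = x 2 - 1 := rfl

/-- The glide shifts the layer by one: the horizontal direction is exchanged. [folklore] -/
theorem hdir_glideFun (x : Site 3) : hdir (glideFun x) = if Even (x 2) then 1 else 0 := by
  by_cases hx : Even (x 2)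
  · rw [if_pos hx, hdir_of_not_even]; rw [glideFun_apply_two, Int.even_add_one]; exact not_not.2 hx
  · rw [if_neg hx, hdir_of_even]; rw [glideFun_apply_two, Int.even_add_one]; exact hx

/-- The inverse glide likewise. [folklore] -/
theorem hdir_glideInv (x : Site 3) : hdir (glideInv x) = if Even (x 2) then 1 else 0 := by
  by_cases hx : Even (x 2)
  · rw [if_pos hx, hdir_of_not_even]; rw [glideInv_apply_two, Int.even_sub_one]; exact not_not.2 hx
  · rw [if_neg hx, hdir_of_even]; rw [glideInv_apply_two, Int.even_sub_one]; exact hx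

/-- The glide preserves adjacency. [folklore] -/
theorem adj_glideFun {x y : Site 3} (h : graph.Adj x y) : graph.Adj (glideFun x) (glideFun y) := by
  rw [graph_adj_iff'] at h ⊢
  rw [hdir_glideFun]
  by_cases hx : Even (x 2)
  · rw [hdir_of_even hx] at h
    rw [if_pos hx]
    rcases h with rfl | rfl | rfl | rfl
    · left; ext i; fin_cases i <;> simp [ev]
    · right; left; ext i; fin_cases i <;> simp [ev]
    · right; right; left; ext i; fin_cases i <;> simp [ev]
    · right; right; right; ext i; fin_cases i <;> simp [ev]
  · rw [hdir_of_not_even hx] at h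
    rw [if_neg hx]
    rcases h with rfl | rfl | rfl | rfl
    · left; ext i; fin_cases i <;> simp [ev]
    · right; left; ext i; fin_cases i <;> simp [ev]
    · right; right; left; ext i; fin_cases i <;> simp [ev]
    · right; right; right; ext i; fin_cases i <;> simp [ev]

/-- The inverse glide preserves adjacency. [folklore] -/
theorem adj_glideInv {x y : Site 3} (h : graph.Adj x y) : graph.Adj (glideInv x) (glideInv y) := by
  rw [graph_adj_iff'] at h ⊢
  rw [hdir_glideInv]
  by_cases hx : Even (x 2)
  · rw [hdir_of_even hx] at h
    rw [if_pos hx]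
    rcases h with rfl | rfl | rfl | rfl
    · left; ext i; fin_cases i <;> simp [ev]
    · right; left; ext i; fin_cases i <;> simp [ev]
    · right; right; left; ext i; fin_cases i <;> simp [ev]
    · right; right; right; ext i; fin_cases i <;> simp [ev]
  · rw [hdir_of_not_even hx] at h
    rw [if_neg hx]
    rcases h with rfl | rfl | rfl | rfl
    · left; ext i; fin_cases i <;> simp [ev]
    · right; left; ext i; fin_cases i <;> simp [ev]
    · right; right; left; ext i; fin_cases i <;> simp [ev]
    · right; right; right; ext i; fin_cases i <;> simp [ev]

/-- **The swap-glide `(x₀, x₁, x₂) ↦ (x₁, x₀, x₂ + 1)` is an automorphism** (it exchanges even and odd layers and the two horizontal directions).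
[cite: BenjaminiSchramm1996, §2] -/
def glide : graph ≃g graph :=
  isoOfMaps glideFun glideInv (fun x => by ext i; fin_cases i <;> simp) (fun x => by ext i; fin_cases i <;> simp)
    (fun _ _ h => adj_glideFun h) (fun _ _ h => adj_glideInv h)

/-- `glide x = (x₁, x₀, x₂ + 1)`. [folklore] -/
@[simp] theorem glide_apply (x : Site 3) : glide x = glideFun x := rfl

/-- The central inversion preserves adjacency. [folklore] -/
theorem adj_neg {x y : Site 3} (h : graph.Adj x y) : graph.Adj (-x) (-y) := by
  rw [graph_adj_iff] at h ⊢
  rw [show -y - -x = -(y - x) by abel, stepsAt_congr (show Even ((-x) 2) ↔ Even (x 2) by rw [Pi.neg_apply, even_neg])]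
  rw [mem_stepsAt_iff] at h ⊢
  rcases h with h | h | h | h <;> rw [h]
  · exact Or.inr (Or.inl rfl)
  · rw [neg_neg]; exact Or.inl rfl
  · exact Or.inr (Or.inr (Or.inr rfl))
  · rw [neg_neg]; exact Or.inr (Or.inr (Or.inl rfl))

/-- **The central inversion `x ↦ −x` is an automorphism.** [cite: KozmaNitzan2024, §4 Lemma 8 p. 16] -/
def negIso : graph ≃g graph :=
  isoOfMaps (fun x => -x) (fun x => -x) (fun x => by simp) (fun x => by simp) (fun _ _ h => adj_neg h) (fun _ _ h => adj_neg h)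

/-- `negIso x = −x`. [folklore] -/
@[simp] theorem negIso_apply (x : Site 3) : negIso x = -x := rfl

/-- The vertical flip `(x₀, x₁, x₂) ↦ (x₀, x₁, −x₂)`. [folklore] -/
def flipZFun (x : Site 3) : Site 3 := ![x 0, x 1, -x 2]

/-- Coordinates of the vertical flip. [folklore] -/
@[simp] theorem flipZFun_apply_zero (x : Site 3) : flipZFun x 0 = x 0 := rfl
/-- Coordinates of the vertical flip. [folklore] -/
@[simp] theorem flipZFun_apply_one (x : Site 3) : flipZFun x 1 = x 1 := rfl
/-- Coordinates of the vertical flip. [folklore] -/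
@[simp] theorem flipZFun_apply_two (x : Site 3) : flipZFun x 2 = -x 2 := rfl

/-- The vertical flip keeps the layer parity. [folklore] -/
theorem hdir_flipZFun (x : Site 3) : hdir (flipZFun x) = hdir x :=
  hdir_congr (by rw [flipZFun_apply_two, even_neg])

/-- The vertical flip preserves adjacency. [folklore] -/
theorem adj_flipZFun {x y : Site 3} (h : graph.Adj x y) : graph.Adj (flipZFun x) (flipZFun y) := by
  rw [graph_adj_iff'] at h ⊢
  rw [hdir_flipZFun]
  have h2 := ev_hdir_apply_two x
  by_cases hx : Even (x 2)
  · rw [hdir_of_even hx] at h ⊢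
    rcases h with rfl | rfl | rfl | rfl
    · left; ext i; fin_cases i <;> simp [ev]
    · right; left; ext i; fin_cases i <;> simp [ev]
    · right; right; right; ext i; fin_cases i <;> simp [ev]; omega
    · right; right; left; ext i; fin_cases i <;> simp [ev]; omega
  · rw [hdir_of_not_even hx] at h ⊢
    rcases h with rfl | rfl | rfl | rfl
    · left; ext i; fin_cases i <;> simp [ev]
    · right; left; ext i; fin_cases i <;> simp [ev]
    · right; right; right; ext i; fin_cases i <;> simp [ev]; omega
    · right; right; left; ext i; fin_cases i <;> simp [ev]; omega

/-- **The vertical flip is an automorphism** (an axis flip over the chart of file II). [cite: KozmaNitzan2024, §4 Lemma 8 p. 16] -/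
def flipZIso : graph ≃g graph :=
  isoOfMaps flipZFun flipZFun (fun x => by ext i; fin_cases i <;> simp) (fun x => by ext i; fin_cases i <;> simp)
    (fun _ _ h => adj_flipZFun h) (fun _ _ h => adj_flipZFun h)

/-- `flipZIso x = (x₀, x₁, −x₂)`. [folklore] -/
@[simp] theorem flipZIso_apply (x : Site 3) : flipZIso x = flipZFun x := rfl

/-! ## §3 Transitivity -/

/-- **Every vertex is the image of `0` under an automorphism**: an even translation, or an even translation after the glide. [folklore] -/
theorem exists_iso_apply_zero (v : Site 3) : ∃ γ : graph ≃g graph, γ 0 = v := by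
  by_cases hv : Even (v 2)
  · exact ⟨shift v hv, by simp⟩
  · refine ⟨(glide).trans (shift (v - ev 2) ?_), ?_⟩
    · rw [Pi.sub_apply, ev_two_apply_two, Int.even_sub_one]; exact hv
    · rw [RelIso.trans_apply, glide_apply, shift_apply]
      ext i; fin_cases i <;> simp [ev]

/-- **The `cds` net is vertex-transitive.** [cite: BenjaminiSchramm1996, §2] -/
theorem graph_transitive : IsGraphTransitive graph := fun x y => by
  obtain ⟨γx, hx⟩ := exists_iso_apply_zero x
  obtain ⟨γy, hy⟩ := exists_iso_apply_zero y
  refine ⟨γx.symm.trans γy, ?_⟩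
  rw [RelIso.trans_apply, ← hx, RelIso.symm_apply_apply, hy]

/-- … hence quasi-transitive. [folklore] -/
theorem graph_quasiTransitive : IsQuasiTransitive graph := by
  refine ⟨{0}, fun v => ?_⟩
  obtain ⟨γ, hγ⟩ := graph_transitive v 0
  exact ⟨γ, by simp [hγ]⟩

end Cds

end Summit.CriticalPhenomena.PercolationContinuityZ3.Theorems.Transplant

end
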